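import Summits.QuantumFields.BalabanUV.Beta.GAN24.SourcePairingLevelOneClosed

/-!
# `BalabanUV.Beta.GAN24.SourcePairingLevelOneGeneric` — binder row G-an2-4 ∕ (CONV-C), the (S) row ∕ (W-γ) one level up, the (η) step at the base, GENERIC DATA:
# **THE SOURCE PAIRING AT LEVEL ONE AT BAŁABAN's PINS FOR GENERIC DATA, DEFECTS DISPLAYED —
# `X_1(h; n, φ)[S0NAt] = −½·⟨φ⁺⊙h, C_0 n⟩ + ¼·⟨C_0 h, σ_φ⊙n⟩ + ¼·(C2′)_0(h; n, φ) + cΛ·X_1[SΛ_0](h; n, φ)`**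
# (every direction-wise summable `h`, bounded `n`, bounded `φ`; centred root, `cE = Lc^{d+1}`, `cVH = −Lc^{d+1}·½·Lc^{d+1}`, every `cΛ`)
# (G-an2-4 CRUX TEAM (2), seat `b2b-balaban-gan24-formalise-leaf-06` = the (γ) hand, gen 50, INTENT 3, PART 2′ — the base case of the level induction)

NOT IN PRINT; OUR BOOKKEEPING ([folklore] BY NAME: the same assembly as `SourcePairingLevelOneClosed.sourcePairing_levelOne_closed` WITHOUT the two vanishing inputs ((δ2b) and the
two-level Λ-zero), so that the identity holds for GENERIC data — the form the level induction consumes at the responses `(H_1 h, H_1 n, φ∘blk)` (memo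
`HOME/b2b-balaban-gan24-formalise-leaf-06/g50/LEVELS-GE2.md` §2–§3); inputs: PART 1 `SourcePairingLevelOneSectors`, leaf-02 g61's PART 4b ∕ PART 2, `colM_coDressKBmAt_KInvStep_swap`, the slot × bond
Fubini; 0 `def`, 0 cited fact, 0 `def … : Prop`, 0 sorry).
HONEST FRAMING (cell contract, verbatim): «discharging `BetaPertH` makes Bałaban's UV stability UNCONDITIONAL — a real constructive-QFT result; it is NOT the continuum limit and NOT
the Clay problem.»  HONEST DEPENDENCY (verbatim): «continuum YM on T⁴ ⇐ BetaPertH ∧ nine spine estimates (0/9 proved); BetaPertH ⇐ (D1) ∧ (D4) ∧ CAP+tail; G-an2-4 gates asym,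
D1 and NE2/3/4.»

* **`sourcePairing_levelOne_generic`** — the statement in the title: the `(C1′)` terms of the Wilson and border sectors cancel at the pins for ALL data; what remains besides the
  closed form is `¼·(C2′)_0(h; n, φ)` (in (δ2b)'s letters with `C_0 h` written through `colM G_0`) and the Lagrange sector `cΛ·X_1[SLam Lc (lamCoeffK (KInvStep Lc 0) (E2 0) Lc) hessFFAt]`
  (whose closed form is `LambdaSectorSourcePairingZero.lambdaSector_slotSum_eq_closed`).
Asserts NO value of any resolvent column beyond the inputs named; NOTHING of `hX` ∕ (W-γ) at levels ≥ 1 ∕ (INV) ∕ (Π) ∕ (S) discharged; NEVER «G-an2-4 closed» as (CONV-C); NOT D1,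
NOT `BetaPertH`, NOT continuum, NOT Clay.  2026-08-23; no existing file touched.
-/

noncomputable section

open Finset
open scoped BigOperators
open Literature.MathematicalPhysics.QuantumFieldTheory
open Literature.MathematicalPhysics.QuantumFieldTheory.Balaban1983to89
open Literature.MathematicalPhysics.QuantumFieldTheory.Balaban1983to89.Beta
open B12Sec2to5 (l1 l1_nonneg)
open ExpKernelCalculus (Site MKer Decays Zl Zl_nonneg summable_exp_shift' tsum_exp_shift')
open OneStepResolventKernel (Fib LocStencil)
open AffineAveraging (Form1 box toSite unitVec dz)
open AveragingContours (blk)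
open AveragingContoursRooted (ctrOff ctrOff_mem_box)
open AveragingHessianKernelsRooted (vhSAt locStencil_vhSAt hessFFAt)
open InterLevelTransport (SLam)
open KernelSpecInstance (wΦ)
open StepJetData (wilsonA locStencil_wilsonA)
open OneStepKernelFamily (KInvStep colH)
open SecondOrderResponse (colM)
open BalabanStepJetsSucc (E2 lamCoeffK)
open Summit.QuantumFields.BalabanUV.Beta.AxialDressingRooted (coDressKBmAt decays_coDressKBmAt_KInvStep one_le_of_neZero)
open Summit.QuantumFields.BalabanUV.Beta.BorderedHessian (stepScale)
open Summit.QuantumFields.BalabanUV.Beta.KernelWardLevels (stepScale_zero)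
open Summit.QuantumFields.BalabanUV.Beta.SpineRooted (S0NAt e3OfK locStencil_e3OfK)
open Summit.QuantumFields.BalabanUV.Beta.KernelWardMColumn (colM_coDressKBmAt)
open Summit.QuantumFields.BalabanUV.Beta.GAN24.MultiplierZeroMass (colM_KInvStep)
open Summit.QuantumFields.BalabanUV.Beta.GAN24.MultiplierVertexBondSum (abs_colM_le_fine)
open Summit.QuantumFields.BalabanUV.Beta.GAN24.TransverseDictionary (wΦ_symm)
open Summit.QuantumFields.BalabanUV.Beta.GAN24.CoarseGaugeSourceResponse (summable_bdd_mul)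
open Summit.QuantumFields.BalabanUV.Beta.GAN24.CubicPushGaugeLegUnfolding (summable_weight_col)
open Summit.QuantumFields.BalabanUV.Beta.GAN24.ChargeTowerClimb (summable_colH)
open Summit.QuantumFields.BalabanUV.Beta.GAN24.CubicPushGaugeLegUnfoldingFF (abs_fieldResponse_le')
open Summit.QuantumFields.BalabanUV.Beta.GAN24.CubicSectorLevelDown (summable_uncurry_mul_decay_mul_bdd)
open Summit.QuantumFields.BalabanUV.Beta.GAN24.LambdaMemberPairing (locStencil_SLam_lamCoeffK)
open Summit.QuantumFields.BalabanUV.Beta.GAN24.LambdaSectorSourcePairingZero (lambdaSector_twoLevel_eq_zero)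
open Summit.QuantumFields.BalabanUV.Beta.GAN24.SourcePairingLevelOneSectors (slotSum_S0NAt_eq_sectors summable_slot_mul_legPairing)
open Summit.QuantumFields.BalabanUV.Beta.GAN24.WilsonSectorSourcePairingZero (hasSum_prod_gaugeLeg_e3OfK_wilsonA_zero_ctr)
open Summit.QuantumFields.BalabanUV.Beta.GAN24.BorderSectorSourcePairingSucc (hasSum_prod_gaugeLeg_e3OfK_vhSAt)
open Summit.QuantumFields.BalabanUV.Beta.GAN24.TwoLevelDefectVanishing (twoLevel_defect_eq_zero)

open Summit.QuantumFields.BalabanUV.Beta.GAN24.SourcePairingLevelOneClosed (abs_multResponse_le abs_boxSum_ite_le slotSum_mul_colM_eq summable_slot_mul_tsum_sum slotSum_tsum_sum_mul_eq)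
open Summit.QuantumFields.BalabanUV.Beta.GAN24.WilsonSectorGaugeLegUnfolding (colM_coDressKBmAt_KInvStep_swap)

namespace Summit.QuantumFields.BalabanUV.Beta.GAN24.SourcePairingLevelOneGeneric

variable {d : ℕ} {Lc : ℕ} [NeZero Lc]

/-- NOT IN PRINT; OUR BOOKKEEPING.  **THE SOURCE PAIRING AT LEVEL ONE, GENERIC DATA, DEFECTS DISPLAYED** (centred root `ρ = toSite (ctrOff (d+1) Lc)`, `cE = Lc^{d+1}`,
`cVH = −(Lc^{d+1}·½·Lc^{d+1})`, every `cΛ`; `h` summable along every direction, bounded `n`, bounded `φ`; `G_0 = coDressKBmAt ρ Lc (KInvStep Lc 0)`,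
`(C_0 n)(l,t) = Σ_κ₀ Σ'_u n κ₀ u·colM G_0 Lc κ₀ u l t`, `(C_0 h)(κ,Y) = Σ_l Σ'_t h l t·colM G_0 Lc l t κ Y`, `U = (BO − EI)(H_0 n)` inline):
`X_1(h; n, φ)[S0NAt ρ cE cVH cΛ] = −½·Σ_l Σ'_t h l t·(φ(t+e_l)·(C_0 n)(l,t)) + ¼·Σ'_Y Σ_κ (C_0 h)(κ,Y)·((φ Y + φ(Y+e_κ))·n κ Y) + ¼·Σ'_Y Σ_κ (C_0 h)(κ,Y)·(dzφ κ Y·U κ Y) + cΛ·X_1[SΛ_0](h; n, φ)`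
— the `(C1′)` cancellation at the pins holds for ALL data; the `(C2′)` term and the Lagrange sector are DISPLAYED (they vanish only for two-level ∕ periodic data). -/
theorem sourcePairing_levelOne_generic (cΛ : ℝ) {h : Form1 (d + 1) ℝ} (hh : ∀ l, Summable (h l)) {n : Form1 (d + 1) ℝ} {Bn : ℝ}
    (hnB : ∀ l t, |n l t| ≤ Bn) {φ : Site (d + 1) → ℝ} {Bφ : ℝ} (hφ : ∀ y, |φ y| ≤ Bφ) :
    ∑ l, ∑' t : Site (d + 1), h l t *
        ∑' ux : Site (d + 1) × Site (d + 1), ∑ κ, ∑ κ₂, n κ ux.1 * dz φ κ₂ ux.2 *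
          e3OfK Lc (coDressKBmAt (toSite (ctrOff (d + 1) Lc)) Lc (KInvStep (d := d) Lc 0))
            (S0NAt d Lc (toSite (ctrOff (d + 1) Lc)) ((Lc : ℝ) ^ (d + 1)) (-((Lc : ℝ) ^ (d + 1) * (1 / 2) * (Lc : ℝ) ^ (d + 1))) cΛ) l t ux.1 ux.2 (Sum.inl κ) (Sum.inl κ₂)
      = -(1 / 2 : ℝ) * ∑ l, ∑' t : Site (d + 1), h l t *
            (φ (t + unitVec l) * ∑ κ₀, ∑' u : Site (d + 1), n κ₀ u * colM (coDressKBmAt (toSite (ctrOff (d + 1) Lc)) Lc (KInvStep (d := d) Lc 0)) Lc κ₀ u l t)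
        + (1 / 4 : ℝ) * ∑' Y : Site (d + 1), ∑ κ : Fin (d + 1),
            (∑ l, ∑' t : Site (d + 1), h l t * colM (coDressKBmAt (toSite (ctrOff (d + 1) Lc)) Lc (KInvStep (d := d) Lc 0)) Lc l t κ Y)
              * ((φ Y + φ (Y + unitVec κ)) * n κ Y)
        + (1 / 4 : ℝ) * ∑' Y : Site (d + 1), ∑ κ : Fin (d + 1),
            (∑ l, ∑' t : Site (d + 1), h l t * colM (coDressKBmAt (toSite (ctrOff (d + 1) Lc)) Lc (KInvStep (d := d) Lc 0)) Lc l t κ Y)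
              * (dz φ κ Y * ((∑ b ∈ box (d + 1) Lc, ∑ s ∈ Finset.range Lc, (if Lc ≤ b κ + s then
                    (∑ κ₀, ∑' u : Site (d + 1), n κ₀ u * colH (coDressKBmAt (toSite (ctrOff (d + 1) Lc)) Lc (KInvStep (d := d) Lc 0)) Lc κ₀ u κ
                      ((Lc : ℤ) • Y + toSite b + (s : ℤ) • unitVec κ)) else 0))
                  - ∑ b ∈ box (d + 1) Lc, ∑ s ∈ Finset.range Lc, (if b κ + s + 1 < Lc then
                    (∑ κ₀, ∑' u : Site (d + 1), n κ₀ u * colH (coDressKBmAt (toSite (ctrOff (d + 1) Lc)) Lc (KInvStep (d := d) Lc 0)) Lc κ₀ u κ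
                      ((Lc : ℤ) • Y + toSite b + (s : ℤ) • unitVec κ)) else 0)))
        + cΛ * ∑ l, ∑' t : Site (d + 1), h l t * ∑' ux : Site (d + 1) × Site (d + 1), ∑ κ, ∑ κ₂, n κ ux.1 * dz φ κ₂ ux.2 *
            e3OfK Lc (coDressKBmAt (toSite (ctrOff (d + 1) Lc)) Lc (KInvStep (d := d) Lc 0))
              (SLam Lc (lamCoeffK (KInvStep (d := d) Lc 0) (E2 d Lc 0) Lc) (fun μ y => hessFFAt (toSite (ctrOff (d + 1) Lc)) Lc μ y)) l t ux.1 ux.2 (Sum.inl κ) (Sum.inl κ₂) := by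
  classical
  have hLc1 : 1 ≤ Lc := one_le_of_neZero Lc
  have hr := ctrOff_mem_box (d := d + 1) hLc1
  have hL : (Lc : ℝ) ^ (d + 1) ≠ 0 := pow_ne_zero _ (by exact_mod_cast NeZero.ne Lc)
  obtain ⟨δG, CG, hδG, hCG, hG⟩ := decays_coDressKBmAt_KInvStep (d := d) hr 0
  have hn' : ∀ (κ : Fin (d + 1)) (u : Site (d + 1)), |n κ u| ≤ Bn := hnB
  have hBn : 0 ≤ Bn := (abs_nonneg _).trans (hnB 0 0)
  have hBφ : 0 ≤ Bφ := (abs_nonneg _).trans (hφ 0)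
  -- (0) the three sectors; the Lagrange sector is kept as it is
  rw [slotSum_S0NAt_eq_sectors hr _ _ cΛ hh hnB hφ, add_left_inj]
  -- (1) the Wilson and border sectors per slot
  have hW := fun (l : Fin (d + 1)) (t : Site (d + 1)) => (hasSum_prod_gaugeLeg_e3OfK_wilsonA_zero_ctr (d := d) (Lc := Lc) l t hn' hφ).tsum_eq
  have hV := fun (l : Fin (d + 1)) (t : Site (d + 1)) => (hasSum_prod_gaugeLeg_e3OfK_vhSAt hr 0 l t hn' hφ).tsum_eq
  -- summability of the two slot families (the pushed families are local)
  obtain ⟨C1, δ1, hδ1, hT1⟩ := locStencil_e3OfK (N := Lc) hLc1 ⟨δG, CG, hδG, hCG, hG⟩ (locStencil_wilsonA (d := d) zero_le_one) one_pos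
  obtain ⟨C2, δ2, hδ2, hT2⟩ := locStencil_e3OfK (N := Lc) hLc1 ⟨δG, CG, hδG, hCG, hG⟩ (locStencil_vhSAt hLc1 hr zero_le_one) one_pos
  have hsW := fun l => summable_slot_mul_legPairing hT1 hδ1 hn' hφ hh l
  have hsV := fun l => summable_slot_mul_legPairing hT2 hδ2 hn' hφ hh l
  simp only [hW] at hsW
  simp only [hV] at hsV
  simp only [hW, hV]
  -- the border sector's `C_0 n` in the Wilson sector's letters (exchange symmetry of the multiplier column)
  have hCn : ∀ (μ : Fin (d + 1)) (Y : Site (d + 1)), (∑ κ, ∑' u : Site (d + 1), n κ u * colM (coDressKBmAt (toSite (ctrOff (d + 1) Lc)) Lc (KInvStep (d := d) Lc 0)) Lc μ Y κ u)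
      = ∑ κ₀, ∑' u : Site (d + 1), n κ₀ u * colM (coDressKBmAt (toSite (ctrOff (d + 1) Lc)) Lc (KInvStep (d := d) Lc 0)) Lc κ₀ u μ Y :=
    fun μ Y => Finset.sum_congr rfl fun κ _ => tsum_congr fun u => by rw [colM_coDressKBmAt_KInvStep_swap]
  simp only [hCn] at hsV ⊢
  -- abbreviations for the per-slot objects
  set G : MKer (d + 1) (Fib d) := coDressKBmAt (toSite (ctrOff (d + 1) Lc)) Lc (KInvStep (d := d) Lc 0) with hGdef
  set Cn : Fin (d + 1) → Site (d + 1) → ℝ := fun κ Y => ∑ κ₀, ∑' u : Site (d + 1), n κ₀ u * colM G Lc κ₀ u κ Y with hCndef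
  set U : Fin (d + 1) → Site (d + 1) → ℝ := fun κ Y =>
    (∑ b ∈ box (d + 1) Lc, ∑ s ∈ Finset.range Lc, (if Lc ≤ b κ + s then
        (∑ κ₀, ∑' u : Site (d + 1), n κ₀ u * colH G Lc κ₀ u κ ((Lc : ℤ) • Y + toSite b + (s : ℤ) • unitVec κ)) else 0))
      - ∑ b ∈ box (d + 1) Lc, ∑ s ∈ Finset.range Lc, (if b κ + s + 1 < Lc then
        (∑ κ₀, ∑' u : Site (d + 1), n κ₀ u * colH G Lc κ₀ u κ ((Lc : ℤ) • Y + toSite b + (s : ℤ) • unitVec κ)) else 0) with hUdef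
  show ((Lc : ℝ) ^ (d + 1) * ∑ l, ∑' t : Site (d + 1), h l t *
        ((stepScale d Lc 0 * (Lc : ℝ) ^ (d + 1))⁻¹ *
          (-(1 / 2 : ℝ) * ((stepScale d Lc 0)⁻¹ * (φ (t + unitVec l) * Cn l t)
              - ∑' Y : Site (d + 1), ∑ κ : Fin (d + 1), Cn κ Y * (dz φ κ Y * ∑ b ∈ box (d + 1) Lc, ∑ s ∈ Finset.range Lc, (if b κ + s + 1 < Lc then
                  colH G Lc l t κ ((Lc : ℤ) • Y + toSite b + (s : ℤ) • unitVec κ) else 0)))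
            + (1 / 4 : ℝ) * ((stepScale d Lc 0)⁻¹ * (∑' Y : Site (d + 1), ∑ κ : Fin (d + 1), colM G Lc l t κ Y * ((φ Y + φ (Y + unitVec κ)) * n κ Y))
              + ∑' Y : Site (d + 1), ∑ κ : Fin (d + 1), colM G Lc l t κ Y * (dz φ κ Y * U κ Y))))
      + -((Lc : ℝ) ^ (d + 1) * (1 / 2) * (Lc : ℝ) ^ (d + 1)) * ∑ l, ∑' t : Site (d + 1), h l t *
        ((stepScale d Lc 0 * (Lc : ℝ) ^ (d + 1))⁻¹ * ((Lc : ℝ) ^ (d + 1))⁻¹ *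
          ∑' Y : Site (d + 1), ∑ κ : Fin (d + 1), Cn κ Y * (dz φ κ Y * ∑ b ∈ box (d + 1) Lc, ∑ s ∈ Finset.range Lc, (if b κ + s + 1 < Lc then
              colH G Lc l t κ ((Lc : ℤ) • Y + toSite b + (s : ℤ) • unitVec κ) else 0))))
      = -(1 / 2 : ℝ) * ∑ l, ∑' t : Site (d + 1), h l t * (φ (t + unitVec l) * Cn l t)
        + (1 / 4 : ℝ) * ∑' Y : Site (d + 1), ∑ κ : Fin (d + 1), (∑ l, ∑' t : Site (d + 1), h l t * colM G Lc l t κ Y) * ((φ Y + φ (Y + unitVec κ)) * n κ Y)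
        + (1 / 4 : ℝ) * ∑' Y : Site (d + 1), ∑ κ : Fin (d + 1), (∑ l, ∑' t : Site (d + 1), h l t * colM G Lc l t κ Y) * (dz φ κ Y * U κ Y)
  -- bounds: `C_0 n`, `H_0 n`, `U`, the multiplier columns of `G_0`
  obtain ⟨BC, hBC0, hCb⟩ := abs_multResponse_le (d := d) hr 0 hn'
  have hCb' : ∀ κ Y, |Cn κ Y| ≤ BC := fun κ Y => (hCb κ Y).2
  obtain ⟨BH, hBH0, hHb⟩ := abs_fieldResponse_le' (d := d) hr 0 hn'
  have hUb : ∀ κ Y, |U κ Y| ≤ (box (d + 1) Lc).card * ((Finset.range Lc).card * BH) + (box (d + 1) Lc).card * ((Finset.range Lc).card * BH) := by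
    intro κ Y
    refine (abs_sub _ _).trans (add_le_add ?_ ?_)
    · exact abs_boxSum_ite_le _ _ hBH0 fun b s => hHb κ _
    · exact abs_boxSum_ite_le _ _ hBH0 fun b s => hHb κ _
  have hcol : ∀ (l : Fin (d + 1)) (t : Site (d + 1)) (κ : Fin (d + 1)) (Y : Site (d + 1)), |colM G Lc l t κ Y| ≤ CG * Real.exp (-δG * l1 (Y - t)) :=
    fun l t κ Y => abs_colM_le_fine (N := Lc) hG hδG.le l t κ Y
  have hw1 : ∀ (κ : Fin (d + 1)) (Y : Site (d + 1)), |(φ Y + φ (Y + unitVec κ)) * n κ Y| ≤ 2 * Bφ * Bn := fun κ Y => by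
    rw [abs_mul]
    have h1 : |φ Y + φ (Y + unitVec κ)| ≤ 2 * Bφ := ((abs_add_le _ _).trans (add_le_add (hφ Y) (hφ (Y + unitVec κ)))).trans (by linarith)
    exact mul_le_mul h1 (hnB κ Y) (abs_nonneg _) (by positivity)
  have hw2 : ∀ (κ : Fin (d + 1)) (Y : Site (d + 1)), |dz φ κ Y * U κ Y|
      ≤ 2 * Bφ * ((box (d + 1) Lc).card * ((Finset.range Lc).card * BH) + (box (d + 1) Lc).card * ((Finset.range Lc).card * BH)) := fun κ Y => by
    rw [abs_mul]
    exact mul_le_mul (KKTFluctuationEnergy.abs_dz_le hφ κ Y) (hUb κ Y) (abs_nonneg _) (by positivity)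
  -- (2) combine the two sectors into one slot sum and do the pin algebra per slot
  have hsA : ∀ l, Summable fun t : Site (d + 1) => h l t * (φ (t + unitVec l) * Cn l t) := fun l =>
    (summable_bdd_mul (hh l) (fun t => show |φ (t + unitVec l) * Cn l t| ≤ Bφ * BC by
      rw [abs_mul]; exact mul_le_mul (hφ _) (hCb' l t) (abs_nonneg _) hBφ)).congr fun t => by ring
  have hsM : ∀ l, Summable fun t : Site (d + 1) => h l t * ∑' Y : Site (d + 1), ∑ κ, colM G Lc l t κ Y * ((φ Y + φ (Y + unitVec κ)) * n κ Y) :=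
    fun l => summable_slot_mul_tsum_sum hδG hCG hcol hh hw1 l
  have hsD : ∀ l, Summable fun t : Site (d + 1) => h l t * ∑' Y : Site (d + 1), ∑ κ, colM G Lc l t κ Y * (dz φ κ Y * U κ Y) :=
    fun l => summable_slot_mul_tsum_sum hδG hCG hcol hh hw2 l
  have hpin : ∀ (A C1 M C2 : ℝ),
      (Lc : ℝ) ^ (d + 1) * ((stepScale d Lc 0 * (Lc : ℝ) ^ (d + 1))⁻¹ *
          (-(1 / 2 : ℝ) * ((stepScale d Lc 0)⁻¹ * A - C1) + (1 / 4 : ℝ) * ((stepScale d Lc 0)⁻¹ * M + C2)))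
        + -((Lc : ℝ) ^ (d + 1) * (1 / 2) * (Lc : ℝ) ^ (d + 1)) * ((stepScale d Lc 0 * (Lc : ℝ) ^ (d + 1))⁻¹ * ((Lc : ℝ) ^ (d + 1))⁻¹ * C1)
        = -(1 / 2 : ℝ) * A + (1 / 4 : ℝ) * M + (1 / 4 : ℝ) * C2 := by
    intro A C1 M C2
    rw [stepScale_zero]
    field_simp
    ring
  have e2 : ((Lc : ℝ) ^ (d + 1) * ∑ l, ∑' t : Site (d + 1), h l t *
        ((stepScale d Lc 0 * (Lc : ℝ) ^ (d + 1))⁻¹ *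
          (-(1 / 2 : ℝ) * ((stepScale d Lc 0)⁻¹ * (φ (t + unitVec l) * Cn l t)
              - ∑' Y : Site (d + 1), ∑ κ : Fin (d + 1), Cn κ Y * (dz φ κ Y * ∑ b ∈ box (d + 1) Lc, ∑ s ∈ Finset.range Lc, (if b κ + s + 1 < Lc then
                  colH G Lc l t κ ((Lc : ℤ) • Y + toSite b + (s : ℤ) • unitVec κ) else 0)))
            + (1 / 4 : ℝ) * ((stepScale d Lc 0)⁻¹ * (∑' Y : Site (d + 1), ∑ κ : Fin (d + 1), colM G Lc l t κ Y * ((φ Y + φ (Y + unitVec κ)) * n κ Y))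
              + ∑' Y : Site (d + 1), ∑ κ : Fin (d + 1), colM G Lc l t κ Y * (dz φ κ Y * U κ Y))))
      + -((Lc : ℝ) ^ (d + 1) * (1 / 2) * (Lc : ℝ) ^ (d + 1)) * ∑ l, ∑' t : Site (d + 1), h l t *
        ((stepScale d Lc 0 * (Lc : ℝ) ^ (d + 1))⁻¹ * ((Lc : ℝ) ^ (d + 1))⁻¹ *
          ∑' Y : Site (d + 1), ∑ κ : Fin (d + 1), Cn κ Y * (dz φ κ Y * ∑ b ∈ box (d + 1) Lc, ∑ s ∈ Finset.range Lc, (if b κ + s + 1 < Lc then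
              colH G Lc l t κ ((Lc : ℤ) • Y + toSite b + (s : ℤ) • unitVec κ) else 0))))
      = ∑ l, ∑' t : Site (d + 1), h l t * (-(1 / 2 : ℝ) * (φ (t + unitVec l) * Cn l t)
          + (1 / 4 : ℝ) * (∑' Y : Site (d + 1), ∑ κ : Fin (d + 1), colM G Lc l t κ Y * ((φ Y + φ (Y + unitVec κ)) * n κ Y))
          + (1 / 4 : ℝ) * (∑' Y : Site (d + 1), ∑ κ : Fin (d + 1), colM G Lc l t κ Y * (dz φ κ Y * U κ Y))) := by
    rw [Finset.mul_sum, Finset.mul_sum, ← Finset.sum_add_distrib]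
    refine Finset.sum_congr rfl fun l _ => ?_
    rw [← tsum_mul_left, ← tsum_mul_left, ← Summable.tsum_add ((hsW l).mul_left _) ((hsV l).mul_left _)]
    refine tsum_congr fun t => ?_
    linear_combination (h l t) * hpin (φ (t + unitVec l) * Cn l t)
      (∑' Y : Site (d + 1), ∑ κ : Fin (d + 1), Cn κ Y * (dz φ κ Y * ∑ b ∈ box (d + 1) Lc, ∑ s ∈ Finset.range Lc, (if b κ + s + 1 < Lc then
          colH G Lc l t κ ((Lc : ℤ) • Y + toSite b + (s : ℤ) • unitVec κ) else 0)))
      (∑' Y : Site (d + 1), ∑ κ : Fin (d + 1), colM G Lc l t κ Y * ((φ Y + φ (Y + unitVec κ)) * n κ Y))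
      (∑' Y : Site (d + 1), ∑ κ : Fin (d + 1), colM G Lc l t κ Y * (dz φ κ Y * U κ Y))
  rw [e2]
  -- (3) split the slot sum into its three terms
  have e3 : (∑ l, ∑' t : Site (d + 1), h l t * (-(1 / 2 : ℝ) * (φ (t + unitVec l) * Cn l t)
          + (1 / 4 : ℝ) * (∑' Y : Site (d + 1), ∑ κ : Fin (d + 1), colM G Lc l t κ Y * ((φ Y + φ (Y + unitVec κ)) * n κ Y))
          + (1 / 4 : ℝ) * (∑' Y : Site (d + 1), ∑ κ : Fin (d + 1), colM G Lc l t κ Y * (dz φ κ Y * U κ Y))))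
      = -(1 / 2 : ℝ) * ∑ l, ∑' t : Site (d + 1), h l t * (φ (t + unitVec l) * Cn l t)
        + (1 / 4 : ℝ) * ∑ l, ∑' t : Site (d + 1), h l t * ∑' Y : Site (d + 1), ∑ κ : Fin (d + 1), colM G Lc l t κ Y * ((φ Y + φ (Y + unitVec κ)) * n κ Y)
        + (1 / 4 : ℝ) * ∑ l, ∑' t : Site (d + 1), h l t * ∑' Y : Site (d + 1), ∑ κ : Fin (d + 1), colM G Lc l t κ Y * (dz φ κ Y * U κ Y) := by
    rw [Finset.mul_sum, Finset.mul_sum, Finset.mul_sum, ← Finset.sum_add_distrib, ← Finset.sum_add_distrib]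
    refine Finset.sum_congr rfl fun l _ => ?_
    rw [← tsum_mul_left, ← tsum_mul_left, ← tsum_mul_left, ← Summable.tsum_add ((hsA l).mul_left _) ((hsM l).mul_left _),
      ← Summable.tsum_add (((hsA l).mul_left _).add ((hsM l).mul_left _)) ((hsD l).mul_left _)]
    exact tsum_congr fun t => by ring
  rw [e3]
  -- (4) the two slot × bond Fubinis
  rw [slotSum_tsum_sum_mul_eq hδG hCG hcol hh hw1, slotSum_tsum_sum_mul_eq hδG hCG hcol hh hw2]

end Summit.QuantumFields.BalabanUV.Beta.GAN24.SourcePairingLevelOneGeneric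

end
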